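import Summits.Ventures.PercRepro.RankLevelSetCoreLarge

/-!
# PercRepro — THEOREM C∞ on the core with EXPLICIT thresholds at `q = 3, 4, 5` (night-1, gen 3)

`proofs/NIGHT-1-C025-induction.md` §14.4. `core_all_corank_of_thresholds` (`RankLevelSetCoreLarge`) takes the two
regime thresholds as hypotheses; here they are discharged numerically:

* **`mul_pow_le_two_pow_of_base`** — `c·N^k ≤ 2^N` and `(N+1)^k ≤ 2·N^k` (with `1 ≤ N`) give `c·n^k ≤ 2^n` for every
  `n ≥ N` (induction: `(n+1)/n ≤ (N+1)/N`, so each step at most doubles the left side while the right side doubles);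
* **`c025_core_three_explicit`** — every finite matroid of rank `p ≥ 45` with an `e`-free partition for every element and
  `|E| ≥ p + 15` satisfies `C-025` at `(p, 3)` (regime thresholds `N₁ = 45`, `P₂ = 41`);
* **`c025_core_four_explicit`** — the same at `(p, 4)` for `p ≥ 109`, `|E| ≥ p + 25` (`N₁ = 109`, `P₂ = 60`);
* **`c025_core_five_explicit`** — the same at `(p, 5)` for `p ≥ 256`, `|E| ≥ p + 43` (`N₁ = 256`, `P₂ = 88`).
These are CORE statements (the hypothesis of the wrapper `rls_succ_large` beyond corank `2q + 2^q`); the all-matroid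
Theorem C∞ stays existential because its bounded-corank half is Theorem C. Axioms: standard.
-/

open scoped Matroid

namespace PercRepro

/-- **An explicit polynomial-versus-`2^n` threshold**: if `c·N^k ≤ 2^N` and `(N + 1)^k ≤ 2·N^k` with `1 ≤ N`, then
`c·n^k ≤ 2^n` for every `n ≥ N`. -/
theorem mul_pow_le_two_pow_of_base (c k N : ℕ) (hN : 1 ≤ N) (h0 : c * N ^ k ≤ 2 ^ N)
    (h1 : (N + 1) ^ k ≤ 2 * N ^ k) : ∀ n, N ≤ n → c * n ^ k ≤ 2 ^ n := by
  intro n hn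
  induction n, hn using Nat.le_induction with
  | base => exact h0
  | succ n hn ih =>
    have hNk : 0 < N ^ k := pow_pos hN k
    have hcross : (n + 1) * N ≤ (N + 1) * n := by nlinarith
    have hstep : (n + 1) ^ k * N ^ k ≤ 2 * n ^ k * N ^ k := by
      calc (n + 1) ^ k * N ^ k = ((n + 1) * N) ^ k := by rw [mul_pow]
        _ ≤ ((N + 1) * n) ^ k := Nat.pow_le_pow_left hcross k
        _ = (N + 1) ^ k * n ^ k := by rw [mul_pow]
        _ ≤ 2 * N ^ k * n ^ k := Nat.mul_le_mul_right _ h1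
        _ = 2 * n ^ k * N ^ k := by ring
    have hstep' : (n + 1) ^ k ≤ 2 * n ^ k := Nat.le_of_mul_le_mul_right hstep hNk
    calc c * (n + 1) ^ k ≤ c * (2 * n ^ k) := Nat.mul_le_mul_left c hstep'
      _ = 2 * (c * n ^ k) := by ring
      _ ≤ 2 * 2 ^ n := Nat.mul_le_mul_left 2 ih
      _ = 2 ^ (n + 1) := by ring

namespace ThmN

variable {α : Type}

/-- **The core of Theorem C∞ at `q = 3`, explicit**: rank `p ≥ 45`, every element with an `e`-free partition,
`|E| ≥ p + 15` ⇒ `Φ(p, 3)·#U(p, 3) ≤ #Y(p, 3)`. -/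
theorem c025_core_three_explicit (M : Matroid α) [M.Finite] (p : ℕ) (hp : 45 ≤ p) (hR : M.eRank = (p : ℕ∞))
    (hbig : p + 14 < M.E.ncard)
    (hfree : ∀ e ∈ M.E, ∃ A ⊆ M.E \ {e}, e ∉ M.closure A ∧ e ∉ M.closure ((M.E \ {e}) \ A)) : RLS M p 3 := by
  have hN₁ : ∀ n, 45 ≤ n → 8 * 2 ^ 3 * n ^ (2 ^ 3 - 1) ≤ 2 ^ n :=
    mul_pow_le_two_pow_of_base (8 * 2 ^ 3) (2 ^ 3 - 1) 45 (by norm_num) (by norm_num) (by norm_num)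
  have hP₂ : ∀ n, 41 ≤ n → 2 ^ (2 ^ 3 - 1) * 2 ^ (3 * 3 + 3) * n ^ (3 + 1) ≤ 2 ^ n :=
    mul_pow_le_two_pow_of_base (2 ^ (2 ^ 3 - 1) * 2 ^ (3 * 3 + 3)) (3 + 1) 41 (by norm_num) (by norm_num)
      (by norm_num)
  have hmax : max (max 45 41) (2 ^ 3 + 2) = 45 := by decide
  refine core_all_corank_of_thresholds 3 (by norm_num) 45 41 hN₁ hP₂ M p (by rw [hmax]; exact hp) hR ?_ hfree
  norm_num
  exact hbig

/-- **The core of Theorem C∞ at `q = 4`, explicit**: rank `p ≥ 109`, every element with an `e`-free partition,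
`|E| ≥ p + 25` ⇒ `Φ(p, 4)·#U(p, 4) ≤ #Y(p, 4)`. -/
theorem c025_core_four_explicit (M : Matroid α) [M.Finite] (p : ℕ) (hp : 109 ≤ p) (hR : M.eRank = (p : ℕ∞))
    (hbig : p + 24 < M.E.ncard)
    (hfree : ∀ e ∈ M.E, ∃ A ⊆ M.E \ {e}, e ∉ M.closure A ∧ e ∉ M.closure ((M.E \ {e}) \ A)) : RLS M p 4 := by
  have hN₁ : ∀ n, 109 ≤ n → 8 * 2 ^ 4 * n ^ (2 ^ 4 - 1) ≤ 2 ^ n :=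
    mul_pow_le_two_pow_of_base (8 * 2 ^ 4) (2 ^ 4 - 1) 109 (by norm_num) (by norm_num) (by norm_num)
  have hP₂ : ∀ n, 60 ≤ n → 2 ^ (2 ^ 4 - 1) * 2 ^ (3 * 4 + 3) * n ^ (4 + 1) ≤ 2 ^ n :=
    mul_pow_le_two_pow_of_base (2 ^ (2 ^ 4 - 1) * 2 ^ (3 * 4 + 3)) (4 + 1) 60 (by norm_num) (by norm_num)
      (by norm_num)
  have hmax : max (max 109 60) (2 ^ 4 + 2) = 109 := by decide
  refine core_all_corank_of_thresholds 4 (by norm_num) 109 60 hN₁ hP₂ M p (by rw [hmax]; exact hp) hR ?_ hfree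
  norm_num
  exact hbig

/-- **The core of Theorem C∞ at `q = 5`, explicit**: rank `p ≥ 256`, every element with an `e`-free partition,
`|E| ≥ p + 43` ⇒ `Φ(p, 5)·#U(p, 5) ≤ #Y(p, 5)`. -/
theorem c025_core_five_explicit (M : Matroid α) [M.Finite] (p : ℕ) (hp : 256 ≤ p) (hR : M.eRank = (p : ℕ∞))
    (hbig : p + 42 < M.E.ncard)
    (hfree : ∀ e ∈ M.E, ∃ A ⊆ M.E \ {e}, e ∉ M.closure A ∧ e ∉ M.closure ((M.E \ {e}) \ A)) : RLS M p 5 := by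
  have hN₁ : ∀ n, 256 ≤ n → 8 * 2 ^ 5 * n ^ (2 ^ 5 - 1) ≤ 2 ^ n :=
    mul_pow_le_two_pow_of_base (8 * 2 ^ 5) (2 ^ 5 - 1) 256 (by norm_num) (by norm_num) (by norm_num)
  have hP₂ : ∀ n, 88 ≤ n → 2 ^ (2 ^ 5 - 1) * 2 ^ (3 * 5 + 3) * n ^ (5 + 1) ≤ 2 ^ n :=
    mul_pow_le_two_pow_of_base (2 ^ (2 ^ 5 - 1) * 2 ^ (3 * 5 + 3)) (5 + 1) 88 (by norm_num) (by norm_num)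
      (by norm_num)
  have hmax : max (max 256 88) (2 ^ 5 + 2) = 256 := by decide
  refine core_all_corank_of_thresholds 5 (by norm_num) 256 88 hN₁ hP₂ M p (by rw [hmax]; exact hp) hR ?_ hfree
  norm_num
  exact hbig

end ThmN

end PercRepro
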